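import Summits.MatrixMultiplication.MatrixMultiplication.Theses.WindowedCompletionRank

/-!
# MatrixMultiplication / WindowedCompletionRank — `WeylToThesis` (stmt-MatrixMultiplication-5499)

Route `WindowedCompletionRank`, support glue
`WeylToThesis : WeylPresentation → WeylCompletion → Thesis`.

Given `ε > 0`, the Weyl-frame completion family (`WeylCompletion` at `δ = ε`) provides `m ≥ 2`,
`k ≥ 1` and a completion `S` of the Weyl cocycle on `G = (ℤ_m^k)²` (written
`(Fin k → ZMod m) × (Fin k → ZMod m)`) with `R(S) ≤ m^(ε k)`. Put `n = m^k`; then `|G| = n²`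
exactly, so `|G| ≤ n^(2+ε)`, and `m^(ε k) = n^ε`. Any bijection
`e : [n] × [n] ≃ G` (one exists by counting, `Fintype.equivOfCardEq`) serves as all three index maps
`α = β = γ = e`, and the clock-and-shift presentation `WeylPresentation` says precisely that
`⟨n,n,n⟩` is a restriction of the pulled-back twisted table `[e b + e c = e a]·S(e a, e b, e c)`,
which is the windowed Hadamard product of `Thesis` for these maps. Pure bookkeeping; no named fact.
-/

-- the tree's namespace `Summit.MatrixMultiplication.MatrixMultiplication.…` repeats a component by design
set_option linter.dupNamespace false

namespace Summit.MatrixMultiplication.MatrixMultiplication.Theorems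

open Summit.MatrixMultiplication.MatrixMultiplication.Theses.WindowedCompletionRank

/-- **Glue `WeylToThesis`** (route WindowedCompletionRank, stmt-MatrixMultiplication-5499):
`WeylPresentation → WeylCompletion → Thesis`. For `ε > 0` take `(m, k, S)` from `WeylCompletion ε`,
`n = m^k`, `G = (Fin k → ZMod m) × (Fin k → ZMod m)` (so `|G| = n² ≤ n^(2+ε)` and
`R(S) ≤ m^(εk) = n^ε`), `α = β = γ =` a counting bijection `[n]² ≃ G`, and the restriction
`⟨n,n,n⟩ ≤ [e b + e c = e a]·S(e a, e b, e c)` from `WeylPresentation`. -/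
theorem weylToThesis_proof :
    Summit.MatrixMultiplication.MatrixMultiplication.Theses.WindowedCompletionRank.WeylToThesis := by
  unfold WeylToThesis WeylPresentation WeylCompletion Thesis
  intro hP hC ε hε
  obtain ⟨m, hm, k, hk, S, hS, hrank⟩ := hC ε hε
  haveI : NeZero m := ⟨by omega⟩
  have h1m : 1 ≤ m := by omega
  -- the group `G = (ℤ_m^k)²` and a counting bijection `[m^k]² ≃ G`
  have hcardG : Fintype.card ((Fin k → ZMod m) × (Fin k → ZMod m)) = m ^ k * m ^ k := by
    simp [Fintype.card_prod, Fintype.card_pi, ZMod.card, Finset.prod_const]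
  have hcardF : Fintype.card (Fin (m ^ k) × Fin (m ^ k)) = m ^ k * m ^ k := by
    simp [Fintype.card_prod]
  let e : Fin (m ^ k) × Fin (m ^ k) ≃ (Fin k → ZMod m) × (Fin k → ZMod m) :=
    Fintype.equivOfCardEq (hcardF.trans hcardG.symm)
  -- real-number bookkeeping on `n = m^k`
  have hn2 : 2 ≤ m ^ k := by
    calc 2 ≤ m := hm
      _ = m ^ 1 := (pow_one m).symm
      _ ≤ m ^ k := Nat.pow_le_pow_right (by omega) hk
  have hm0 : (0 : ℝ) ≤ (m : ℝ) := Nat.cast_nonneg m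
  have hN1 : (1 : ℝ) ≤ ((m ^ k : ℕ) : ℝ) := by exact_mod_cast (le_trans (by norm_num) hn2)
  have hN0 : (0 : ℝ) < ((m ^ k : ℕ) : ℝ) := by linarith
  refine ⟨m ^ k, hn2, (Fin k → ZMod m) × (Fin k → ZMod m), inferInstance, inferInstance,
    inferInstance, ?_, e, e, e, S, ?_, hP m k h1m S hS e⟩
  · -- `|G| = n² ≤ n^(2+ε)`
    rw [hcardG, Real.rpow_add hN0, Real.rpow_two]
    have hε1 : (1 : ℝ) ≤ ((m ^ k : ℕ) : ℝ) ^ ε := Real.one_le_rpow hN1 hε.le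
    have hsq : (((m ^ k * m ^ k : ℕ) : ℝ)) = ((m ^ k : ℕ) : ℝ) ^ 2 := by
      push_cast
      ring
    rw [hsq]
    nlinarith [sq_nonneg (((m ^ k : ℕ) : ℝ))]
  · -- `R(S) ≤ m^(εk) = n^ε`
    refine hrank.trans (le_of_eq ?_)
    rw [mul_comm ε (k : ℝ), Real.rpow_mul hm0, Real.rpow_natCast]
    push_cast
    rfl

end Summit.MatrixMultiplication.MatrixMultiplication.Theorems
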